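import Mathlib
import Summits.NavierStokesRegularity.FluidComputer.CertifierNormBounds
import Summits.NavierStokesRegularity.FluidComputer.HermitianLoewnerNormBound
import HarnessLib

/-!
# The deterministic half of the «lane float» pivot certificate of `d2s_cert.py` (Cholesky backward error ⇒ certified `λ_min`): D2S-FLOATCERT F3/F4 as kernel lemmas (cap2 g2, cell `ns-blowup`, 2026-08-26)

HONEST FRAMING (human ruling D-0035): nothing here is a claim about Navier–Stokes blow-up.
WHAT THIS IS NOT: not NS evidence. MODEL/linear bookkeeping about a CERTIFICATE FORMAT. The three
THEOREM 3-L certificates of the cap2 ladder (R 300 classes I/II, R 500 class II; STATUS l.2586 /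
l.2844 / l.3947; engine `HOME/cap2/d2s_cert.py` 526db1ca2d823856) certify their dense HEAD pivot
(`n_h = 14 905`, `10 367`, `20 683`) in «lane float» (`HOME/cap2/D2S-FLOATCERT.md` 299b13a3ff5a3389):
instead of 128-bit ball Gershgorin-after-congruence (cap's `CongruenceGershgorinPosDef`), a binary64
Cholesky factorisation of `B = fl(S − cI)` is run to completion and the printed lower bound is
`λ_min(S) ≥ c − g·tr(B)/(1−g) − ρ_d` (LEMMA FC, F3), handed on as an exactly Hermitian lower object
through `λ_min(S_true) ≥ LEMMA-FC(M) − ‖R‖₂` (F4, Weyl). That argument has two halves: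
(i) a ROUNDING-ERROR THEOREM about the algorithm (Higham, *Accuracy and Stability of Numerical
Algorithms*, Thm 10.3 + Thm 10.5 = Demmel 1989; Rump, BIT 46 (2006)): if Cholesky in IEEE arithmetic
runs to completion on the floating-point Hermitian matrix `B` then the computed factor satisfies
`R̂ᴴR̂ = B + ΔB` EXACTLY with `|ΔB_ij| ≤ g' dᵢ dⱼ`, `dᵢ = b_ii^{1/2}`, `g' = g/(1−g)` — this half is a
statement about floating-point arithmetic and stays the script's stated model assumption (F0);
(ii) the DETERMINISTIC half «such a factorisation-with-rank-one-majorised-residual forces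
`λ_min(B) ≥ −g'·tr B`», plus the shift, the diagonal rounding `ρ_d`, and the enclosure step F4. This
file proves (ii) over `ℝ`/`ℂ` (any `RCLike` field), Mathlib + `CertifierNormBounds` (p-landed weighted
Schur test and factor-residual bound) + `HermitianLoewnerNormBound`; no new definitions:

* `l2_opNorm_le_of_entry_le_rank_one` — `|E_ij| ≤ g dᵢ dⱼ` with `d > 0` ⇒ `‖E‖₂ ≤ g Σ dᵢ²`
  (Demmel's rank-one majorant; weighted Schur test with weights `d`);
* `re_quadForm_ge_of_cholesky_backward_error` — `RᴴR = B + ΔB`, `|ΔB_ij| ≤ g dᵢ dⱼ` ⇒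
  `Re(vᴴBv) ≥ −(g Σdᵢ²)‖v‖²`; `…_trace` — with `dᵢ² = Re b_ii` the constant is `g·Re tr B`;
* `re_quadForm_ge_of_shifted_cholesky` — LEMMA FC as printed: `RᴴR = B + ΔB` for a matrix `B` with
  `‖B − (S − c·1)‖₂ ≤ ρ` (the diagonal rounding of `fl(S − cI)`) ⇒ `Re(vᴴSv) ≥ (c − gΣdᵢ² − ρ)‖v‖²`;
* `re_quadForm_ge_of_norm_sub_le` — F4: a quadratic-form lower bound `η` for `M` and `‖S − M‖₂ ≤ r`
  give the bound `η − r` for `S` (Weyl, in quadratic-form language);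
* `posSemidef_sub_smul_one_of_re_quadForm_ge` / `posDef_of_re_quadForm_ge` — packaging for the Schur
  recursion (`MonotoneSchurStep.posDef_fromBlocks_of_pivot_lowerBound` wants `L.PosDef`): a Hermitian
  `S` with `Re(vᴴSv) ≥ η‖v‖²` has `S − η·1 ≽ 0`, and `S ≻ 0` if `η > 0`;
* `posDef_of_shifted_cholesky` — the composed sentence the VERDICT line quotes for a float-lane level:
  exactly Hermitian `S`, a completed Cholesky of a `ρ`-perturbation of `S − c·1` with rank-one-majorised
  backward error, and `c − gΣdᵢ² − ρ > 0` ⇒ `S ≻ 0`.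

After this file the float lane's referee-read list is (F0) alone (the IEEE model + Higham's two theorems
+ the outward evaluation of the bound expressions), exactly as the ball lane's is «the ball arithmetic
of the entries» (D2-CHAIN-MAP S4 (c)).
-/

namespace Summit.NavierStokesRegularity.FluidComputer.FloatLaneCholeskyCriterion

open scoped Matrix.Norms.L2Operator ComplexOrder
open Matrix WithLp Finset
open Summit.NavierStokesRegularity.FluidComputer.CertifierNormBounds
open Summit.NavierStokesRegularity.FluidComputer.HermitianLoewnerNormBound

variable {𝕜 : Type*} [RCLike 𝕜] {n : Type*} [Fintype n] [DecidableEq n]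

/-! ## §1 Demmel's rank-one majorant in the spectral norm -/

/-- **Rank-one entrywise majorant ⇒ spectral-norm bound.** If `‖E i j‖ ≤ g·dᵢdⱼ` for positive weights
`d` and `g ≥ 0`, then `‖E‖₂ ≤ g·Σᵢ dᵢ²` (`= g·‖d dᵀ‖₂`). Weighted Schur test with `p = q = d`. -/
theorem l2_opNorm_le_of_entry_le_rank_one (E : Matrix n n 𝕜) (d : n → ℝ) (hd : ∀ i, 0 < d i)
    {g : ℝ} (hg : 0 ≤ g) (h : ∀ i j, ‖E i j‖ ≤ g * (d i * d j)) :
    ‖E‖ ≤ g * ∑ i, d i ^ 2 := by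
  set c : ℝ := g * ∑ i, d i ^ 2 with hc
  have hc0 : 0 ≤ c := mul_nonneg hg (Finset.sum_nonneg fun i _ => sq_nonneg _)
  have hrow : ∀ i, ∑ j, ‖E i j‖ * d j ≤ c * d i := by
    intro i
    calc ∑ j, ‖E i j‖ * d j ≤ ∑ j, g * (d i * d j) * d j :=
          Finset.sum_le_sum fun j _ => mul_le_mul_of_nonneg_right (h i j) (hd j).le
      _ = c * d i := by
          rw [hc, Finset.mul_sum, Finset.sum_mul]
          exact Finset.sum_congr rfl fun j _ => by ring
  have hcol : ∀ j, ∑ i, ‖E i j‖ * d i ≤ c * d j := by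
    intro j
    calc ∑ i, ‖E i j‖ * d i ≤ ∑ i, g * (d i * d j) * d i :=
          Finset.sum_le_sum fun i _ => mul_le_mul_of_nonneg_right (h i j) (hd i).le
      _ = c * d j := by
          rw [hc, Finset.mul_sum, Finset.sum_mul]
          exact Finset.sum_congr rfl fun i _ => by ring
  have hS := l2_opNorm_le_of_weightedSchur E d d hd hc0 hc0 hrow hcol
  rwa [Real.sqrt_mul_self hc0] at hS

/-! ## §2 LEMMA FC: completed Cholesky with rank-one-majorised backward error ⇒ certified `λ_min` -/

omit [DecidableEq n] in
/-- `Re (v† v) = Σ ‖v_i‖²` is nonnegative. -/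
private theorem sum_norm_sq_nonneg (v : n → 𝕜) : 0 ≤ ∑ i, ‖v i‖ ^ 2 :=
  Finset.sum_nonneg fun i _ => by positivity

/-- **LEMMA FC, core.** If `RᴴR = B + ΔB` (a Cholesky factor computed for `B`, with its EXACT backward
error `ΔB`) and `|ΔB_ij| ≤ g dᵢ dⱼ` for positive weights `d`, then `Re(vᴴBv) ≥ −(g Σᵢdᵢ²)·Σ‖vᵢ‖²` for
every `v` — `λ_min(B) ≥ −g Σdᵢ²` in quadratic-form language. -/
theorem re_quadForm_ge_of_cholesky_backward_error (B R ΔB : Matrix n n 𝕜) (d : n → ℝ)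
    (hd : ∀ i, 0 < d i) {g : ℝ} (hg : 0 ≤ g) (hfac : Rᴴ * R = B + ΔB)
    (hΔ : ∀ i j, ‖ΔB i j‖ ≤ g * (d i * d j)) (v : n → 𝕜) :
    -((g * ∑ i, d i ^ 2) * ∑ i, ‖v i‖ ^ 2) ≤ RCLike.re (star v ⬝ᵥ B *ᵥ v) := by
  have hE : ‖-ΔB‖ ≤ g * ∑ i, d i ^ 2 := by
    rw [norm_neg]; exact l2_opNorm_le_of_entry_le_rank_one ΔB d hd hg hΔ
  have hfac' : B = Rᴴ * Rᴴᴴ + (-ΔB) := by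
    rw [conjTranspose_conjTranspose, hfac]; abel
  exact re_quadForm_ge_neg_of_factor_residual B Rᴴ (-ΔB) hfac' hE v

/-- **LEMMA FC with Demmel's weights `dᵢ² = b_ii`:** the constant is `g·Re tr B`
(D2S-FLOATCERT F3: «`λ_min ≥ c − g·tr(B)/(1−g)`», the `g` here being the note's `g/(1−g)`). -/
theorem re_quadForm_ge_of_cholesky_backward_error_trace (B R ΔB : Matrix n n 𝕜) (d : n → ℝ)
    (hd : ∀ i, 0 < d i) (hdiag : ∀ i, d i ^ 2 = RCLike.re (B i i)) {g : ℝ} (hg : 0 ≤ g)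
    (hfac : Rᴴ * R = B + ΔB) (hΔ : ∀ i j, ‖ΔB i j‖ ≤ g * (d i * d j)) (v : n → 𝕜) :
    -((g * RCLike.re B.trace) * ∑ i, ‖v i‖ ^ 2) ≤ RCLike.re (star v ⬝ᵥ B *ᵥ v) := by
  have htr : RCLike.re B.trace = ∑ i, d i ^ 2 := by
    rw [Matrix.trace, map_sum]
    exact Finset.sum_congr rfl fun i _ => by rw [Matrix.diag_apply, hdiag i]
  rw [htr]
  exact re_quadForm_ge_of_cholesky_backward_error B R ΔB d hd hg hfac hΔ v

/-- **LEMMA FC as printed (shift + diagonal rounding).** `S` is the (exactly Hermitian) matrix whose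
smallest eigenvalue is wanted; the algorithm factors a floating-point matrix `B` with
`‖B − (S − c·1)‖₂ ≤ ρ` (for `B = fl(S − cI)` only the diagonal is rounded, `ρ = ρ_d`); if the
factorisation completes with backward error `|ΔB_ij| ≤ g dᵢ dⱼ`, then
`Re(vᴴSv) ≥ (c − gΣdᵢ² − ρ)·Σ‖vᵢ‖²` for every `v`. -/
theorem re_quadForm_ge_of_shifted_cholesky (S B R ΔB : Matrix n n 𝕜) (c ρ : ℝ) (d : n → ℝ)
    (hd : ∀ i, 0 < d i) {g : ℝ} (hg : 0 ≤ g) (hfac : Rᴴ * R = B + ΔB)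
    (hΔ : ∀ i j, ‖ΔB i j‖ ≤ g * (d i * d j))
    (hB : ‖B - (S - (c : 𝕜) • (1 : Matrix n n 𝕜))‖ ≤ ρ) (v : n → 𝕜) :
    (c - g * ∑ i, d i ^ 2 - ρ) * ∑ i, ‖v i‖ ^ 2 ≤ RCLike.re (star v ⬝ᵥ S *ᵥ v) := by
  have h1 := re_quadForm_ge_of_cholesky_backward_error B R ΔB d hd hg hfac hΔ v
  set D : Matrix n n 𝕜 := B - (S - (c : 𝕜) • (1 : Matrix n n 𝕜)) with hD
  have h2 := abs_re_quadForm_le_l2_opNorm D v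
  have h2' : ‖D‖ * ∑ i, ‖v i‖ ^ 2 ≤ ρ * ∑ i, ‖v i‖ ^ 2 :=
    mul_le_mul_of_nonneg_right hB (sum_norm_sq_nonneg v)
  have h3 := (abs_le.mp (h2.trans h2')).2
  have hS : S = B - D + (c : 𝕜) • (1 : Matrix n n 𝕜) := by rw [hD]; abel
  rw [hS, add_mulVec, sub_mulVec, dotProduct_add, dotProduct_sub, map_add, map_sub,
    re_quadForm_smul_one]
  linarith

/-! ## §3 F4 (enclosure ⇒ true matrix) and the Loewner packaging for the Schur recursion -/

/-- **F4 (Weyl, quadratic-form form).** If `Re(vᴴMv) ≥ η·Σ‖vᵢ‖²` for every `v` and `‖S − M‖₂ ≤ r`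
then `Re(vᴴSv) ≥ (η − r)·Σ‖vᵢ‖²` for every `v` — the certified lower bound of the exactly Hermitian
midpoint `M` of a float-interval object transfers to every member `S` of the enclosure minus the
radius bound `r ≥ √(‖R‖₁‖R‖_∞)` (`CertifierNormBounds.l2_opNorm_le_sqrt_rowSum_mul_colSum`). -/
theorem re_quadForm_ge_of_norm_sub_le (S M : Matrix n n 𝕜) {η r : ℝ}
    (hM : ∀ v : n → 𝕜, η * ∑ i, ‖v i‖ ^ 2 ≤ RCLike.re (star v ⬝ᵥ M *ᵥ v))
    (hr : ‖S - M‖ ≤ r) (v : n → 𝕜) :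
    (η - r) * ∑ i, ‖v i‖ ^ 2 ≤ RCLike.re (star v ⬝ᵥ S *ᵥ v) := by
  have h1 := hM v
  have h2 := abs_re_quadForm_le_l2_opNorm (S - M) v
  have h2' : ‖S - M‖ * ∑ i, ‖v i‖ ^ 2 ≤ r * ∑ i, ‖v i‖ ^ 2 :=
    mul_le_mul_of_nonneg_right hr (sum_norm_sq_nonneg v)
  have h3 := (abs_le.mp (h2.trans h2')).1
  have hS : S = M + (S - M) := by abel
  rw [hS, add_mulVec, dotProduct_add, map_add]
  linarith

/-- **Quadratic-form lower bound ⇒ Loewner bound.** A Hermitian `S` with `Re(vᴴSv) ≥ η·Σ‖vᵢ‖²` for all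
`v` satisfies `S − η·1 ≽ 0` — the «certified lower object» `L = S − η·1 ≼ S` the next Schur level
receives. -/
theorem posSemidef_sub_smul_one_of_re_quadForm_ge {S : Matrix n n 𝕜} (hS : S.IsHermitian) {η : ℝ}
    (h : ∀ v : n → 𝕜, η * ∑ i, ‖v i‖ ^ 2 ≤ RCLike.re (star v ⬝ᵥ S *ᵥ v)) :
    (S - (η : 𝕜) • (1 : Matrix n n 𝕜)).PosSemidef := by
  refine PosSemidef.of_dotProduct_mulVec_nonneg (hS.sub (isHermitian_ofReal_smul_one η)) fun x => ?_
  rw [sub_mulVec, dotProduct_sub, RCLike.nonneg_iff]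
  constructor
  · rw [map_sub, re_quadForm_smul_one, sub_nonneg]
    exact h x
  · rw [map_sub, hS.im_star_dotProduct_mulVec_self,
      (isHermitian_ofReal_smul_one η).im_star_dotProduct_mulVec_self, sub_zero]

omit [DecidableEq n] in
/-- **… and positive definiteness when the certified bound is positive:** Hermitian `S`,
`Re(vᴴSv) ≥ η·Σ‖vᵢ‖²` for all `v`, `η > 0` ⇒ `S ≻ 0` (the form
`MonotoneSchurStep.posDef_fromBlocks_of_pivot_lowerBound` consumes). -/
theorem posDef_of_re_quadForm_ge {S : Matrix n n 𝕜} (hS : S.IsHermitian) {η : ℝ} (hη : 0 < η)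
    (h : ∀ v : n → 𝕜, η * ∑ i, ‖v i‖ ^ 2 ≤ RCLike.re (star v ⬝ᵥ S *ᵥ v)) : S.PosDef := by
  refine PosDef.of_dotProduct_mulVec_pos hS fun x hx => ?_
  rw [RCLike.pos_iff]
  constructor
  · have hx' : 0 < ∑ i, ‖x i‖ ^ 2 := by
      obtain ⟨i, hi⟩ := Function.ne_iff.mp hx
      exact lt_of_lt_of_le (by positivity : 0 < ‖x i‖ ^ 2)
        (Finset.single_le_sum (f := fun j => ‖x j‖ ^ 2) (fun j _ => by positivity) (Finset.mem_univ i))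
    exact lt_of_lt_of_le (mul_pos hη hx') (h x)
  · exact hS.im_star_dotProduct_mulVec_self x

/-- **The float-lane pivot sentence, composed.** Exactly Hermitian `S`; a floating-point matrix `B`
within `ρ` of `S − c·1` in the spectral norm; a COMPLETED Cholesky factorisation `RᴴR = B + ΔB` whose
backward error is majorised entrywise by `g·dᵢdⱼ` (`d > 0`; Higham Thm 10.3/10.5 supply this with
`dᵢ² = b_ii`, `g = γ̃_{n+1}/(1 − γ̃_{n+1})` under the IEEE model (F0)); and `c − gΣdᵢ² − ρ > 0`. Then
`S ≻ 0` — indeed `S − (c − gΣdᵢ² − ρ)·1 ≽ 0`. -/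
theorem posDef_of_shifted_cholesky {S : Matrix n n 𝕜} (hS : S.IsHermitian) (B R ΔB : Matrix n n 𝕜)
    (c ρ : ℝ) (d : n → ℝ) (hd : ∀ i, 0 < d i) {g : ℝ} (hg : 0 ≤ g) (hfac : Rᴴ * R = B + ΔB)
    (hΔ : ∀ i j, ‖ΔB i j‖ ≤ g * (d i * d j))
    (hB : ‖B - (S - (c : 𝕜) • (1 : Matrix n n 𝕜))‖ ≤ ρ) (hpos : 0 < c - g * ∑ i, d i ^ 2 - ρ) :
    S.PosDef ∧ (S - ((c - g * ∑ i, d i ^ 2 - ρ : ℝ) : 𝕜) • (1 : Matrix n n 𝕜)).PosSemidef :=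
  ⟨posDef_of_re_quadForm_ge hS hpos (re_quadForm_ge_of_shifted_cholesky S B R ΔB c ρ d hd hg hfac hΔ hB),
    posSemidef_sub_smul_one_of_re_quadForm_ge hS
      (re_quadForm_ge_of_shifted_cholesky S B R ΔB c ρ d hd hg hfac hΔ hB)⟩

end Summit.NavierStokesRegularity.FluidComputer.FloatLaneCholeskyCriterion
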